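import Summits.ValiantsHypothesis.ValiantsHypothesis.Theorems.KPlusLogSqLawTropicalShiftLadder
import Summits.ValiantsHypothesis.ValiantsHypothesis.Theorems.KPlusLogSqLawTropicalShiftSquareChain

/-!
# Route «KPlusLogSqLaw» — SHIFT-LADDER, part 2: dominance, signs, the chain; `T(m, 2A+2) ≥ (A·m+1)(m+1) − 1` for every `m`, `A`,
# and the RANK-TWO GAP ROW WITH ONE UNIT DIGIT IS EXACTLY `(A·m+1)(m+1) − 1`

HONEST FRAMING.  Second proof file (pure theorems) of the helper chain `--supports` the crux
`Summit.ValiantsHypothesis.ValiantsHypothesis.Theses.KPlusLogSqLaw.TropicalB` (item `stmt-ValiantsHypothesis-19771`, route `KPlusLogSqLaw`;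
cell `pub-symmetroid`, seat val-sym-trop-p5 g8, 2026-08-27); design in `…TropicalShiftLadderDefs.lean`, per-incidence inequalities in
`…TropicalShiftLadder.lean`.  Proved here, sorry-free:
* `ShiftLadder.isDominant_cterm`: for ALL `p ≤ m`, `a ≤ A·m` the grid term `(σ_p, λ_{p,a})` is the UNIQUE optimum at the integer slope
  `θ(p,a) = 2(W·p + a) + 1`, `W = A·m + 1`, among all `m!·(2A+2)^m` Leibniz terms;
* `ShiftLadder.termSign_cterm`: its sign is `(−1)^{n·p + a}·hsign^p` (`sign σ_p = ((−1)^n)^p` by `ShiftSquare.sign_rot`, the `p` high incidences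
  carry `hsign = (−1)^{(A+1)m}`, the low rungs multiply to `(−1)^a` since `Σ_b lvl a b = a`); along the grid `grid k = (k div W, k mod W)`, `k <
  (m+1)W`, the slopes are `2k + 1` and the signs `(−1)^k` (`termSign_grid`: `n·p + a + (A+1)m·p ≡ W·p + a (mod 2)`);
* **`ladder_le_of_tropRootLawAt (A m B) : TropRootLawAt m (2A+2) B → (A·m+1)(m+1) − 1 ≤ B`** for every `m` and `A`: the tropical census row
  `(m, 2A+2)` is at least `A·m² + (A+1)·m` (`A = 0`: the rotation row `T(m,2) ≥ m`; `A = 1`: SHIFT-SQUARE's `m² + 2m`; `A = 2`: `T(m,6) ≥ 2m² + 3m`;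
  by padding `TropRootLawAt_of_le`-type monotonicity in `K` the odd formats inherit `T(m, 2A+3) ≥ A·m² + (A+1)·m`, not restated here);
* **`gapTwo_row_iff (A m B)`**: among `(m, 2A+2)` designs with exponents `d l = d₀ + a₁(l)·g₁ + a₂(l)·g₂`, digits `a₁ ≤ A`, `a₂ ≤ 1`, a number `B`
  bounds every dominant sign-alternating chain iff `(A·m+1)(m+1) − 1 ≤ B` — val-sym-trop-p1's ceiling `KPlusLogSqLaw.Sumset.chain_succ_le_of_gap`
  (rank `2`, digit bounds `(A, 1)`) is ATTAINED by SHIFT-LADDER for every `m` and `A`.  `A = 1` is `parallelogram_row_four_iff`.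
Reading (no claim beyond the theorems): every rank-two GAP exponent type with ONE unit digit is an exactly solved sector of the tropical census,
quadratic in `m` with leading constant `A`; the located «`K − 2` SHIFT-THREE eras» count `(K−2)m²/2` (val-sym-lift-p3) is this floor's leading term.
Nothing here bears on `TropicalB` / `WeakLifting` in their window, the cell's `K = 4` fork, `MatrixDescartes` (stmt-ValiantsHypothesis-18050) or
`VP ≠ VNP`.
-/

set_option linter.dupNamespace false
set_option autoImplicit false

namespace Summit.ValiantsHypothesis.ValiantsHypothesis.Theorems.LacunarySymmetroidMatrixDescartes.TropicalCensus

open Summit.ValiantsHypothesis.ValiantsHypothesis.Theorems.MatrixDescartes.Negative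
open scoped BigOperators
open Finset

namespace ShiftLadder

open ShiftThree (shiftZ)
open ShiftSquare (rot)

variable (A n : ℕ)

/-! ### identification of an incidence by its effective shift -/

/-- a present incidence with effective shift `p ≤ m` sits on the phase-`p` entry of its column and has the grid's high bit. -/
theorem cell_of_eshift_eq (p a : ℕ) (hp : p ≤ n + 1) (a' b : Fin (n + 1)) (l : Fin (2 * A + 2))
    (h : ee A n a' b l ≠ 0) (hq : eshift A n a' b l = p) :
    a' = rot n p b ∧ hi A l = hi A (lam A n p a b) := by
  rw [hi_lam]
  have h01 := hi_le_one A l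
  unfold eshift at hq
  unfold ee at h
  by_cases hdh : (a' : ℕ) = (b : ℕ) ∧ hi A l = 1
  · rw [if_pos hdh] at hq
    have hp' : p = n + 1 := by omega
    subst hp'
    refine ⟨Fin.ext ?_, by rw [hdh.2, if_pos (by omega)]⟩
    rw [ShiftSquare.rot_last_val]; exact hdh.1
  · rw [if_neg hdh] at hq
    have hpn : p < n + 1 := by have := ShiftSquare.shiftZ_bounds n a' b; omega
    have ha' : a' = rot n p b := ShiftSquare.eq_rot_of_shiftZ_eq_of_lt n p hpn a' b hq
    refine ⟨ha', ?_⟩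
    have hv := ShiftSquare.rot_val n p hp b
    rw [← ha'] at hv
    by_cases hw : (a' : ℕ) < (b : ℕ)
    · rw [if_pos hw] at h
      have hh : hi A l = 1 := by by_contra hh; exact h (by rw [if_neg hh])
      rw [hh]
      by_cases hw' : n + 1 ≤ (b : ℕ) + p
      · rw [if_pos hw']
      · rw [if_neg hw'] at hv; omega
    · rw [if_neg hw] at h
      have hw' : ¬ n + 1 ≤ (b : ℕ) + p := by
        intro hw'
        rw [if_pos hw'] at hv; omega
      rw [if_neg hw']
      by_cases hd : (a' : ℕ) = (b : ℕ)
      · omega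
      · rw [if_neg hd] at h
        by_contra hh
        have hh1 : hi A l = 1 := by omega
        exact h (by rw [if_pos hh1])

/-! ### per-incidence domination -/

/-- **per-incidence domination**: at `θ(p,a)` (`p ≤ m`, `a ≤ A·m`) every present incidence of column `b` scores at most the grid
term's incidence … -/
theorem phi_le (p a : ℕ) (hp : p ≤ n + 1) (ha : a ≤ A * (n + 1)) (a' b : Fin (n + 1)) (l : Fin (2 * A + 2))
    (h : ee A n a' b l ≠ 0) :
    phi A n (th A n p a) a' b l ≤ phi A n (th A n p a) (rot n p b) b (lam A n p a b) := by
  rw [phi_present A n _ a' b l h, phi_cterm A n _ p a hp ha b]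
  have hlo := lo_le A l
  have hloz : (0 : ℤ) ≤ (lo A l : ℤ) := by positivity
  have hloA : (lo A l : ℤ) ≤ A := by exact_mod_cast hlo
  have hW : (0 : ℤ) ≤ (width A n : ℤ) := by positivity
  have hB := bonus_le_lvl A n p a ha b (lo A l)
  set q := eshift A n a' b l with hq
  rcases lt_trichotomy q p with hlt | heq | hgt
  · have h1 := gval_gap_of_lt A n p a q hlt
    have h2 := bonus_shift A n (th A n p a) p q b (lo A l)
    have h3 : (lo A l : ℤ) * (2 * (width A n : ℤ) * ((p : ℤ) - q)) ≤ (A : ℤ) * (2 * (width A n : ℤ) * ((p : ℤ) - q)) :=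
      mul_le_mul_of_nonneg_right hloA (by nlinarith)
    nlinarith
  · rw [heq]
    linarith
  · have h1 := gval_gap_of_gt A n p a ha q hgt
    have h2 := bonus_shift A n (th A n p a) p q b (lo A l)
    have h3 : (lo A l : ℤ) * (2 * (width A n : ℤ) * ((p : ℤ) - q)) ≤ 0 :=
      mul_nonpos_of_nonneg_of_nonpos hloz (by nlinarith)
    nlinarith

/-- … and strictly less unless it IS the grid term's incidence. -/
theorem phi_lt (p a : ℕ) (hp : p ≤ n + 1) (ha : a ≤ A * (n + 1)) (a' b : Fin (n + 1)) (l : Fin (2 * A + 2))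
    (h : ee A n a' b l ≠ 0) (hne : a' ≠ rot n p b ∨ l ≠ lam A n p a b) :
    phi A n (th A n p a) a' b l < phi A n (th A n p a) (rot n p b) b (lam A n p a b) := by
  rw [phi_present A n _ a' b l h, phi_cterm A n _ p a hp ha b]
  have hlo := lo_le A l
  have hloz : (0 : ℤ) ≤ (lo A l : ℤ) := by positivity
  have hloA : (lo A l : ℤ) ≤ A := by exact_mod_cast hlo
  have hW : (0 : ℤ) ≤ (width A n : ℤ) := by positivity
  have hB := bonus_le_lvl A n p a ha b (lo A l)
  set q := eshift A n a' b l with hq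
  rcases lt_trichotomy q p with hlt | heq | hgt
  · have h1 := gval_gap_of_lt A n p a q hlt
    have h2 := bonus_shift A n (th A n p a) p q b (lo A l)
    have h3 : (lo A l : ℤ) * (2 * (width A n : ℤ) * ((p : ℤ) - q)) ≤ (A : ℤ) * (2 * (width A n : ℤ) * ((p : ℤ) - q)) :=
      mul_le_mul_of_nonneg_right hloA (by nlinarith)
    nlinarith
  · -- same effective shift: same entry and same high bit, so the low level differs
    have heq' : eshift A n a' b l = p := by rw [← hq]; exact heq
    obtain ⟨ha', hhi⟩ := cell_of_eshift_eq A n p a hp a' b l h heq'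
    have hl : l ≠ lam A n p a b := by
      rcases hne with h1 | h1
      · exact absurd ha' h1
      · exact h1
    have hlo' : lo A l ≠ lvl n a b := by
      intro hc
      apply hl
      apply eq_of_digits A
      · rw [hc, lo_lam, min_eq_right (lvl_le A n a ha b)]
      · exact hhi
    rw [heq]
    have h2 := bonus_lt_lvl A n p a ha b (lo A l) hlo'
    linarith
  · have h1 := gval_gap_of_gt A n p a ha q hgt
    have h2 := bonus_shift A n (th A n p a) p q b (lo A l)
    have h3 : (lo A l : ℤ) * (2 * (width A n : ℤ) * ((p : ℤ) - q)) ≤ 0 :=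
      mul_nonpos_of_nonneg_of_nonpos hloz (by nlinarith)
    nlinarith

/-! ### dominance and signs of the grid terms -/

/-- **the grid term `(σ_p, λ_{p,a})` is the unique optimum at `θ(p,a)`**, for all `p ≤ m`, `a ≤ A·m`. -/
theorem isDominant_cterm (p a : ℕ) (hp : p ≤ n + 1) (ha : a ≤ A * (n + 1)) :
    IsDominant (dd A n) (vv A n) (ee A n) (th A n p a) (cterm A n p a) := by
  refine ⟨?_, ?_⟩
  · unfold termSign cterm
    refine mul_ne_zero (Units.ne_zero _) ?_
    rw [Finset.prod_ne_zero_iff]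
    intro b _
    exact ee_cterm_ne_zero A n p a hp b
  · intro q hq hqs
    rw [tropWeight_eq_sum_phi, tropWeight_eq_sum_phi]
    have hpres : ∀ b, ee A n (q.1 b) b (q.2 b) ≠ 0 := by
      intro b
      unfold termSign at hqs
      exact (Finset.prod_ne_zero_iff.mp (right_ne_zero_of_mul hqs)) b (Finset.mem_univ b)
    obtain ⟨b₀, hb₀⟩ : ∃ b, q.1 b ≠ rot n p b ∨ q.2 b ≠ lam A n p a b := by
      by_contra hcon
      push Not at hcon
      apply hq
      unfold cterm
      exact Prod.ext (Equiv.ext fun b => (hcon b).1) (funext fun b => (hcon b).2)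
    unfold cterm
    exact Finset.sum_lt_sum (fun b _ => phi_le A n p a hp ha (q.1 b) b (q.2 b) (hpres b))
      ⟨b₀, Finset.mem_univ _, phi_lt A n p a hp ha (q.1 b₀) b₀ (q.2 b₀) (hpres b₀) hb₀⟩

/-- a product supported on the last `p` columns: `∏_b (if m ≤ b + p then c else 1) = c^p` (`p ≤ m`). -/
theorem prod_ite_high (c : ℤ) (p : ℕ) (hp : p ≤ n + 1) :
    ∏ b : Fin (n + 1), (if n + 1 ≤ (b : ℕ) + p then c else 1) = c ^ p := by
  rw [Fin.prod_univ_eq_prod_range (fun i => if n + 1 ≤ i + p then c else 1) (n + 1)]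
  rw [← Finset.prod_range_mul_prod_Ico _ (show n + 1 - p ≤ n + 1 by omega)]
  rw [Finset.prod_congr rfl (fun i hi => if_neg (by have := Finset.mem_range.mp hi; omega)),
    Finset.prod_congr rfl (fun i hi => if_pos (by have := (Finset.mem_Ico.mp hi).1; omega))]
  simp only [Finset.prod_const_one, one_mul, Finset.prod_const, Nat.card_Ico]
  congr 1; omega

/-- the product of the low signs of a grid term: `∏_b (−1)^{lvl a b} = (−1)^a` (the levels add up to `a`). -/
theorem prod_neg_one_pow_lvl (a : ℕ) : ∏ b : Fin (n + 1), (-1 : ℤ) ^ lvl n a b = (-1) ^ a := by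
  have hc : a % (n + 1) ≤ n + 1 := (Nat.mod_lt a (show 0 < n + 1 by omega)).le
  have h1 : ∀ b : Fin (n + 1), (-1 : ℤ) ^ lvl n a b = (-1) ^ (a / (n + 1)) * (if (b : ℕ) < a % (n + 1) then -1 else 1) := by
    intro b
    unfold lvl
    rw [pow_add]
    split_ifs <;> simp
  rw [Finset.prod_congr rfl (fun b _ => h1 b), Finset.prod_mul_distrib, Finset.prod_const, Finset.card_univ,
    Fintype.card_fin, ShiftThree.prod_neg_one_pow n (a % (n + 1)) hc, ← pow_mul, ← pow_add]
  congr 1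
  rw [Nat.mul_comm]
  exact Nat.div_add_mod a (n + 1)

/-- **sign of the grid term**: `(−1)^{n·p + a} · hsign^p` (`p ≤ m`, `a ≤ A·m`). -/
theorem termSign_cterm (p a : ℕ) (hp : p ≤ n + 1) (ha : a ≤ A * (n + 1)) :
    termSign (ee A n) (cterm A n p a) = (-1) ^ (n * p + a) * hsign A n ^ p := by
  unfold termSign cterm
  dsimp only
  rw [Finset.prod_congr rfl (fun b _ => ee_cterm A n p a hp b)]
  have h1 : ∀ b : Fin (n + 1), lsign A n (lam A n p a b) =
      (-1 : ℤ) ^ lvl n a b * (if n + 1 ≤ (b : ℕ) + p then hsign A n else 1) := by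
    intro b
    unfold lsign
    rw [lo_lam, hi_lam, min_eq_right (lvl_le A n a ha b)]
    by_cases hw : n + 1 ≤ (b : ℕ) + p
    · rw [if_pos hw, if_pos rfl, if_pos hw]
    · rw [if_neg hw, if_neg (by decide), if_neg hw]
  rw [Finset.prod_congr rfl (fun b _ => h1 b), Finset.prod_mul_distrib, prod_neg_one_pow_lvl, prod_ite_high _ _ _ hp,
    ShiftSquare.sign_rot, pow_add]
  ring

/-! ### the chain: lexicographic enumeration of the grid `[0, m] × [0, A·m]` -/

/-- `1 ≤ W`. -/
theorem width_pos : 0 < width A n := by unfold width; omega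

/-- the grid point `k < (m+1)·W` lies in `[0, m] × [0, A·m]`. -/
theorem grid_le (k : ℕ) (hk : k < (n + 2) * width A n) : (grid A n k).1 ≤ n + 1 ∧ (grid A n k).2 ≤ A * (n + 1) := by
  unfold grid
  dsimp only
  have hW := width_pos A n
  constructor
  · have : k / width A n < n + 2 := Nat.div_lt_of_lt_mul (by rw [Nat.mul_comm]; exact hk)
    omega
  · have : k % width A n < width A n := Nat.mod_lt _ hW
    unfold width at this ⊢
    omega

/-- the slope of the `k`-th grid point is `2k + 1`. -/
theorem th_grid (k : ℕ) : th A n (grid A n k).1 (grid A n k).2 = 2 * k + 1 := by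
  unfold grid th
  dsimp only
  have h := Nat.div_add_mod k (width A n)
  have h' : (width A n : ℤ) * (k / width A n : ℕ) + (k % width A n : ℕ) = k := by exact_mod_cast h
  linarith

/-- the slopes increase along the grid. -/
theorem th_grid_lt (k : ℕ) :
    th A n (grid A n k).1 (grid A n k).2 < th A n (grid A n (k + 1)).1 (grid A n (k + 1)).2 := by
  rw [th_grid, th_grid]; push_cast; linarith

/-- the term signs alternate along the grid: the `k`-th sign is `(−1)^k`. -/
theorem termSign_grid (k : ℕ) (hk : k < (n + 2) * width A n) :
    termSign (ee A n) (cterm A n (grid A n k).1 (grid A n k).2) = (-1) ^ k := by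
  obtain ⟨h1, h2⟩ := grid_le A n k hk
  rw [termSign_cterm A n _ _ h1 h2]
  unfold hsign
  rw [← pow_mul, ← pow_add]
  unfold grid
  dsimp only
  rw [neg_one_pow_eq_pow_mod_two, neg_one_pow_eq_pow_mod_two (R := ℤ) k]
  congr 1
  have h := Nat.div_add_mod k (width A n)
  unfold width at h ⊢
  set d := k / (A * (n + 1) + 1) with hd
  set r := k % (A * (n + 1) + 1) with hr
  have e : n * d + r + (A + 1) * (n + 1) * d = ((A * (n + 1) + 1) * d + r) + 2 * (n * d) := by ring
  rw [e, h]
  omega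

/-- **the tropical row `(m, 2A+2)`, `m = n + 1`, is at least `(m+1)·(A·m + 1) − 1`.** -/
theorem le_of_tropRootLawAt_succ (B : ℕ) (h : TropRootLawAt (n + 1) (2 * A + 2) B) : (n + 2) * width A n - 1 ≤ B := by
  have hN : 1 ≤ (n + 2) * width A n := Nat.one_le_iff_ne_zero.mpr (Nat.mul_ne_zero (by omega) (width_pos A n).ne')
  have hmain := h (dd A n) (vv A n) (ee A n) ((n + 2) * width A n - 1) (fun k => th A n (grid A n k).1 (grid A n k).2)
    (fun k => cterm A n (grid A n k).1 (grid A n k).2) (ee_natAbs A n) ?_ ?_ ?_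
  · exact hmain
  · refine Fin.strictMono_iff_lt_succ.mpr fun k => ?_
    simp only [Fin.val_castSucc, Fin.val_succ]
    exact th_grid_lt A n k
  · intro k
    obtain ⟨h1, h2⟩ := grid_le A n k (by omega)
    exact isDominant_cterm A n _ _ h1 h2
  · intro k
    simp only [Fin.val_castSucc, Fin.val_succ]
    rw [termSign_grid A n k (by omega), termSign_grid A n (k + 1) (by omega), ← pow_add,
      show (k : ℕ) + (k + 1) = 2 * k + 1 by ring, pow_succ, pow_mul]
    norm_num

/-- the exponents of SHIFT-LADDER lie in the rank-two progression `{a₁·1 + a₂·D}` with digits `a₁ ≤ A`, `a₂ ≤ 1`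
(in the digit form of `KPlusLogSqLaw.Sumset.chain_succ_le_of_gap`). -/
theorem dd_gap (l : Fin (2 * A + 2)) : dd A n l = 0 + ∑ j : Fin 2, ![lo A l, hi A l] j * ![1, bigD A n] j := by
  rw [Fin.sum_univ_two]
  simp [dd]

end ShiftLadder

/-- **The `K = 2A + 2` tropical census row is at least `(A·m + 1)(m + 1) − 1` for EVERY `m` and every `A`** — the explicit
SHIFT-LADDER design (`A + 1` low rungs times a high bit; `A = 0`: the rotation row `T(m,2) ≥ m`; `A = 1`: SHIFT-SQUARE's `m² + 2m`;
`A = 2`: `T(m,6) ≥ 2m² + 3m`; in general `T(m, 2A+2) ≥ A·m² + (A+1)·m`). -/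
theorem ladder_le_of_tropRootLawAt (A m B : ℕ) (h : TropRootLawAt m (2 * A + 2) B) : (A * m + 1) * (m + 1) - 1 ≤ B := by
  rcases m with _ | n
  · simp
  · have h1 := ShiftLadder.le_of_tropRootLawAt_succ A n B h
    unfold ShiftLadder.width at h1
    have e : (A * (n + 1) + 1) * (n + 1 + 1) = (n + 2) * (A * (n + 1) + 1) := by ring
    rw [e]
    exact h1

/-- **THE RANK-TWO GAP ROW WITH ONE UNIT DIGIT IS EXACTLY `(A·m + 1)(m + 1) − 1`, for every `m` and every `A`.**  Among designs of format
`(m, 2A+2)` whose exponents lie in a generalized arithmetic progression `d l = d₀ + a₁(l)·g₁ + a₂(l)·g₂` with digits `a₁(l) ≤ A`,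
`a₂(l) ≤ 1`, a number `B` bounds the sign changes of every dominant sign-alternating chain iff `(A·m + 1)(m + 1) − 1 ≤ B`: the ceiling is
val-sym-trop-p1's sumset law `KPlusLogSqLaw.Sumset.chain_succ_le_of_gap` (rank `2`, `∏_j (m·A_j + 1) = (mA + 1)(m + 1)`), the floor is
SHIFT-LADDER (exponents `j + h·D`, `j ≤ A`, `h ≤ 1`).  `A = 1` is the parallelogram row `parallelogram_row_four_iff`. -/
theorem gapTwo_row_iff (A m B : ℕ) :
    (∀ (d : Fin (2 * A + 2) → ℕ) (d₀ g₁ g₂ : ℕ) (a₁ a₂ : Fin (2 * A + 2) → ℕ), (∀ l, a₁ l ≤ A) → (∀ l, a₂ l ≤ 1) →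
        (∀ l, d l = d₀ + a₁ l * g₁ + a₂ l * g₂) →
        ∀ (v ε : Fin m → Fin m → Fin (2 * A + 2) → ℤ) (N : ℕ) (θ : Fin (N + 1) → ℤ)
          (p : Fin (N + 1) → Equiv.Perm (Fin m) × (Fin m → Fin (2 * A + 2))),
          (∀ i j l, (ε i j l).natAbs ≤ 1) → StrictMono θ → (∀ k, IsDominant d v ε (θ k) (p k)) →
          (∀ k : Fin N, termSign ε (p k.castSucc) * termSign ε (p k.succ) < 0) → N ≤ B) ↔
      (A * m + 1) * (m + 1) - 1 ≤ B := by
  constructor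
  · intro h
    rcases m with _ | n
    · simp
    · have hW := ShiftLadder.width_pos A n
      have hN : 1 ≤ (n + 2) * ShiftLadder.width A n := Nat.one_le_iff_ne_zero.mpr (Nat.mul_ne_zero (by omega) hW.ne')
      have hmain := h (ShiftLadder.dd A n) 0 1 (ShiftLadder.bigD A n) (ShiftLadder.lo A) (ShiftLadder.hi A)
        (ShiftLadder.lo_le A) (ShiftLadder.hi_le_one A) (fun l => by unfold ShiftLadder.dd; ring)
        (ShiftLadder.vv A n) (ShiftLadder.ee A n) ((n + 2) * ShiftLadder.width A n - 1)
        (fun k => ShiftLadder.th A n (ShiftLadder.grid A n k).1 (ShiftLadder.grid A n k).2)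
        (fun k => ShiftLadder.cterm A n (ShiftLadder.grid A n k).1 (ShiftLadder.grid A n k).2) (ShiftLadder.ee_natAbs A n)
        ?_ ?_ ?_
      · unfold ShiftLadder.width at hmain
        have e : (A * (n + 1) + 1) * (n + 1 + 1) = (n + 2) * (A * (n + 1) + 1) := by ring
        rw [e]; exact hmain
      · refine Fin.strictMono_iff_lt_succ.mpr fun k => ?_
        simp only [Fin.val_castSucc, Fin.val_succ]
        exact ShiftLadder.th_grid_lt A n k
      · intro k
        obtain ⟨h1, h2⟩ := ShiftLadder.grid_le A n k (by omega)
        exact ShiftLadder.isDominant_cterm A n _ _ h1 h2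
      · intro k
        simp only [Fin.val_castSucc, Fin.val_succ]
        rw [ShiftLadder.termSign_grid A n k (by omega), ShiftLadder.termSign_grid A n (k + 1) (by omega), ← pow_add,
          show (k : ℕ) + (k + 1) = 2 * k + 1 by ring, pow_succ, pow_mul]
        norm_num
  · intro hB d d₀ g₁ g₂ a₁ a₂ h₁ h₂ hd v ε N θ p hε hθ hdom halt
    have h := KPlusLogSqLaw.Sumset.chain_succ_le_of_gap d v ε θ p hθ hdom halt (r := 2) d₀ ![g₁, g₂] ![A, 1]
      (fun l => ![a₁ l, a₂ l]) ?_ ?_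
    · rw [Fin.prod_univ_two] at h
      simp only [Matrix.cons_val_zero, Matrix.cons_val_one] at h
      have e : (m * A + 1) * (m * 1 + 1) = (A * m + 1) * (m + 1) := by ring
      rw [e] at h
      omega
    · intro l j
      fin_cases j
      · exact h₁ l
      · exact h₂ l
    · intro l
      rw [hd l, Fin.sum_univ_two]
      simp only [Matrix.cons_val_zero, Matrix.cons_val_one]
      ring



end Summit.ValiantsHypothesis.ValiantsHypothesis.Theorems.LacunarySymmetroidMatrixDescartes.TropicalCensus
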